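import Summits.BirchSwinnertonDyer.Rank1Residual.ManinAdditive.CMGammaOneRootLawBeyondQi
import Summits.BirchSwinnertonDyer.BirchSwinnertonDyer.Theorems.ManinOddAtFour.Negative.KatoNeronIntegralTwoGamma1OptimalOfOddAtFour
import Literature.NumberTheory.EllipticCurves.ComplexMultiplicationLFunctionIsogenyHoldsProofs
import HarnessLib

/-!
# Law 6♭‴ (Kato–Néron integrality at 2, `X₁(N)`-optimal curve) ON THE CM CLASSES — FILE B (T-es-51 (b)) and FILE B′ (T-es-52)
(route `ManinLocalTwoThree`, crux C2 `ManinOddAtFour` stmt-BirchSwinnertonDyer-22967; cell bsd-f2-manin, prover seat p2 gen 18 landing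
planner -es g32's PROVER-ONLY Theorems leaves; `--supports stmt-BirchSwinnertonDyer-22967`)

SOURCE.  §6 `SixFlatCM` of HOME/es/g32/SixFlatCM-scratch-es-g32.lean (sha16 ddc2be77d30f040b; refuter ref1 §R173 ADDENDUM: CLEAN, probe
ProbeR173b.lean 8f43549f7c287544 rc 0, with the LR-free form `Ref1R173b.katoFactTwoAt_on_cmClass_two_noLattice` recommended) and §6′
`SixFlatBeyond` of HOME/es/g32/SixFlatBeyond-scratch-es-g32.lean (T-es-52 routing, typer g20 2026-08-29T16:22Z: «FILE B′ is PROVER-ONLY like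
FILE B»), statements VERBATIM (binder names as in the tree corollaries), bodies = one application of p2's
`ManinOddAtFour.Negative.katoFactTwoAt_of_not_two_dvd_maninConstant` (`2 ∤ c₁(D₁) ⟹ KatoFactTwoAt V D₁.f`, no optimality needed) to es's
landed corollaries COR 46.S₂⁺ (`…CMTwinStevensMinimalMembersCor`, p729422) and COR 47 (`…CMGammaOneRootLawBeyondQi`, p732179).
One module for both leaves (D-0064: one file per source section-group), namespace `…Theorems.ManinLocalTwoThree.KatoNeronCM`.

CONTENT.  The C2 LEAD's skeleton (kato_shift_two v22) carries the law 6♭‴ `KatoCurve.KatoNeronIntegralTwoGamma1OptimalOnBlindCore`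
(`KatoFactTwoAt` at the `X₁(N)`-optimal curve on the blind core).  On the CM sub-slices the conclusion `KatoFactTwoAt V D₁.f` follows with NONE
of 6♭‴'s own clauses (`2⁴ ∣ N`, no odd period relation, blindness), from:
* `ℚ(i)`-classes (a twist-reduced globally minimal root `R`, `c₆(R) = 0`): the root law E-es-152₂ `CMGammaOneRootLawTwoLocal`, the
  classification SHAPE₂⁺ `CMClassMembersTwo`, and Faltings `LFunction_eq_of_isIsogenous` — `katoFactTwoAt_on_cmClass_two_of_rootLaw_of_classMembers`
  (es's binders `(LR, hLR)` kept) and `katoFactTwoAt_on_cmClass_two_noLattice` (ref1 (B1): uniformisation `exists_isNeronLatticeOf_holds`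
  discharges them);
* `ℚ(√−2)`-classes (`j = 8000`): E-es-154 `CMGammaOneRootLawTwoLocalJ8000` alone — `katoFactTwoAt_on_cmClass_sqrtNegTwo_of_rootLaw`;
* `ℚ(√−3)`-classes AT 2 (root `V`, `c₄(V) = 0`, `4 ∣ N`): E-es-155 `CMGammaOneRootLawTwoLocalJ0`, SHAPE₃⁺ `CMClassMembersThree`, Faltings —
  `katoFactTwoAt_on_cmClass_three_of_rootLawAtTwo_of_classMembers` and its lattice-free form `…_noLattice`.
All five are CONDITIONAL on the named cell laws / classification facts they take as hypotheses (E-es-152₂/154/155 are `@[conjecture]` nodes;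
SHAPE₂⁺/₃⁺ are typed classical classification facts).  NEW HERE (§3): the binder `hL : LFunction_eq_of_isIsogenous` («Faltings» in the cell's memos —
in fact Knapp Thm. 11.67, isogenous curves have the same `L`-function) is a TREE THEOREM, `Literature.NumberTheory.EllipticCurves.LFunction_eq_of_isIsogenous_holds`
(`ComplexMultiplicationLFunctionIsogenyHoldsProofs.lean`: `V_ℓ`-isomorphism + the Euler-factor theorem at every place), so the `ℚ(i)` and `ℚ(√−3)` leaves are
given in FULLY DISCHARGED form `katoFactTwoAt_on_cmClass_two` / `katoFactTwoAt_on_cmClass_three_atTwo` — conditional only on the root law and the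
classification fact (no `hL`, no `(LR, hLR)`).

HONEST FRAMING.  Pure composition; law 6♭‴, C2 `ManinOddAtFour`, Manin's conjecture and BSD are NOT proved by this.  No definitions, no sorry,
no new axioms. [folklore]
-/

set_option autoImplicit false
-- lint-debt: the directory name repeats the summit name (sibling precedent `ManinLocalTwoThreeUDCGlue.lean`)
set_option linter.dupNamespace false

noncomputable section

open Complex WeierstrassCurve Literature.NumberTheory.EllipticCurves Literature.NumberTheory.EllipticCurves.ModularForms
open Summit.BirchSwinnertonDyer.Rank1Residual.ManinAdditive
open Summit.BirchSwinnertonDyer.Rank1Residual.ManinAdditive.KatoCurve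
open Summit.BirchSwinnertonDyer.Rank1Residual.ManinAdditive.KatoCurve.CMOptimal
open Summit.BirchSwinnertonDyer.Rank1Residual.ManinAdditive.KatoCurve.CMOptimal.TwinLattice
open Summit.BirchSwinnertonDyer.Rank1Residual.ManinAdditive.KatoCurve.CMTwinMinimal
open Summit.BirchSwinnertonDyer.BirchSwinnertonDyer.Theorems.ManinOddAtFour.Negative (katoFactTwoAt_of_not_two_dvd_maninConstant)

namespace Summit.BirchSwinnertonDyer.BirchSwinnertonDyer.Theorems.ManinLocalTwoThree.KatoNeronCM

variable {N : ℕ} [NeZero N]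

/-! ## §1 FILE B — law 6♭‴ on the `ℚ(i)`-CM classes (T-es-51 (b), §6 `SixFlatCM`) -/

/-- **6♭‴|CM(ℚ(i))**: Kato–Néron integrality at the `X₁(N)`-optimal curve of every `ℚ(i)`-CM class (given its twist-reduced
root `R`, `c₆(R) = 0`, with a Néron lattice and the twist-reduction clause), from the root law E-es-152₂, the classification
SHAPE₂⁺ and `LFunction_eq_of_isIsogenous` (es g32 §6, verbatim; body: p2's `katoFactTwoAt_of_not_two_dvd_maninConstant` ∘ COR 46.S₂⁺).
CONDITIONAL on `h152`, `hcl`, `hL`. [folklore] -/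
theorem katoFactTwoAt_on_cmClass_two_of_rootLaw_of_classMembers
    (h152 : CMGammaOneRootLawTwoLocal) (hcl : CMClassMembersTwo) (hL : LFunction_eq_of_isIsogenous)
    (V : WeierstrassCurve ℚ) [V.IsElliptic] [V.IsGloballyMinimal] (D₁ : Gamma1ParametrizationData V N)
    (hopt : D₁.IsOptimal)
    (R : WeierstrassCurve ℚ) [R.IsElliptic] [R.IsGloballyMinimal] (LR : PeriodPair) (h6 : R.c₆ = 0)
    (hiso : WeierstrassCurve.IsIsogenous R V) (hLR : IsNeronLatticeOf (R.baseChange ℂ) LR)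
    (hred : ∀ (W' : WeierstrassCurve ℚ) [W'.IsElliptic] [W'.IsGloballyMinimal],
        W'.j = 1728 → WeierstrassCurve.IsIsogenous R W' → (W'.c₄ = R.c₄ ∨ W'.c₄ = -4 * R.c₄)) :
    KatoFactTwoAt V D₁.f :=
  katoFactTwoAt_of_not_two_dvd_maninConstant V D₁
    (not_two_dvd_maninConstant₁_on_cmClass_two_of_rootLaw_of_classMembers h152 hcl hL V D₁ hopt R LR h6 hiso hLR hred)

/-- **6♭‴|CM(ℚ(i)), lattice-free form** (ref1 §R173 ADDENDUM (B1)): the binders `(LR, hLR)` are discharged by uniformisation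
(`exists_isNeronLatticeOf_holds`); only the root `R`, `c₆(R) = 0`, and its twist-reduction clause remain as class data. CONDITIONAL on
`h152`, `hcl`, `hL`. [folklore] -/
theorem katoFactTwoAt_on_cmClass_two_noLattice
    (h152 : CMGammaOneRootLawTwoLocal) (hcl : CMClassMembersTwo) (hL : LFunction_eq_of_isIsogenous)
    (V : WeierstrassCurve ℚ) [V.IsElliptic] [V.IsGloballyMinimal] (D₁ : Gamma1ParametrizationData V N)
    (hopt : D₁.IsOptimal)
    (R : WeierstrassCurve ℚ) [R.IsElliptic] [R.IsGloballyMinimal] (h6 : R.c₆ = 0)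
    (hiso : WeierstrassCurve.IsIsogenous R V)
    (hred : ∀ (W' : WeierstrassCurve ℚ) [W'.IsElliptic] [W'.IsGloballyMinimal],
        W'.j = 1728 → WeierstrassCurve.IsIsogenous R W' → (W'.c₄ = R.c₄ ∨ W'.c₄ = -4 * R.c₄)) :
    KatoFactTwoAt V D₁.f := by
  obtain ⟨LR, hLR⟩ := exists_isNeronLatticeOf_holds (R.baseChange ℂ)
  exact katoFactTwoAt_on_cmClass_two_of_rootLaw_of_classMembers h152 hcl hL V D₁ hopt R LR h6 hiso hLR hred

/-! ## §2 FILE B′ — law 6♭‴ beyond `ℚ(i)`: the `ℚ(√−2)` slice and the `ℚ(√−3)` classes at 2 (T-es-52, §6′ `SixFlatBeyond`) -/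

/-- **6♭‴|CM(ℚ(√−2))**: `KatoFactTwoAt` at the `X₁(N)`-optimal curve of every `ℚ(√−2)`-CM class (`j = 8000`), from E-es-154 alone
(es g32 §6′, verbatim; body: `katoFactTwoAt_of_not_two_dvd_maninConstant` ∘ COR 47). CONDITIONAL on `h`. [folklore] -/
theorem katoFactTwoAt_on_cmClass_sqrtNegTwo_of_rootLaw (h : CMGammaOneRootLawTwoLocalJ8000)
    (W : WeierstrassCurve ℚ) [W.IsElliptic] [W.IsGloballyMinimal] (D₁ : Gamma1ParametrizationData W N)
    (hopt : D₁.IsOptimal) (hj : W.j = 8000) : KatoFactTwoAt W D₁.f :=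
  katoFactTwoAt_of_not_two_dvd_maninConstant W D₁
    (not_two_dvd_maninConstant₁_on_cmClass_sqrtNegTwo_of_rootLaw h W D₁ hopt hj)

/-- **6♭‴|CM(ℚ(√−3)) at 2**: `KatoFactTwoAt` at the `X₁(N)`-optimal curve of every `ℚ(√−3)`-CM class with `4 ∣ N`, from E-es-155 at
the twist-reduced root `V` (`c₄(V) = 0`), SHAPE₃⁺ and Faltings (es g32 §6′, verbatim). CONDITIONAL on `h`, `hcl`, `hL`. [folklore] -/
theorem katoFactTwoAt_on_cmClass_three_of_rootLawAtTwo_of_classMembers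
    (h : CMGammaOneRootLawTwoLocalJ0) (hcl : CMClassMembersThree) (hL : LFunction_eq_of_isIsogenous)
    (W : WeierstrassCurve ℚ) [W.IsElliptic] [W.IsGloballyMinimal] (D₁ : Gamma1ParametrizationData W N)
    (hopt : D₁.IsOptimal)
    (V : WeierstrassCurve ℚ) [V.IsElliptic] [V.IsGloballyMinimal] (LV : PeriodPair) (h4 : V.c₄ = 0)
    (hN : 2 ^ 2 ∣ N)
    (hiso : WeierstrassCurve.IsIsogenous V W) (hLV : IsNeronLatticeOf (V.baseChange ℂ) LV)
    (hred : ∀ (W' : WeierstrassCurve ℚ) [W'.IsElliptic] [W'.IsGloballyMinimal],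
        W'.j = 0 → WeierstrassCurve.IsIsogenous V W' → (W'.c₆ = V.c₆ ∨ W'.c₆ = -27 * V.c₆)) :
    KatoFactTwoAt W D₁.f :=
  katoFactTwoAt_of_not_two_dvd_maninConstant W D₁
    (not_two_dvd_maninConstant₁_on_cmClass_three_of_rootLawAtTwo_of_classMembers h hcl hL W D₁ hopt V LV h4 hN
      hiso hLV hred)

/-- 6♭‴ on the `ℚ(√−3)`-CM classes at 2, lattice-free form (binders `(LV, hLV)` discharged by `exists_isNeronLatticeOf_holds`).
CONDITIONAL on `h`, `hcl`, `hL`. [folklore] -/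
theorem katoFactTwoAt_on_cmClass_three_of_rootLawAtTwo_noLattice
    (h : CMGammaOneRootLawTwoLocalJ0) (hcl : CMClassMembersThree) (hL : LFunction_eq_of_isIsogenous)
    (W : WeierstrassCurve ℚ) [W.IsElliptic] [W.IsGloballyMinimal] (D₁ : Gamma1ParametrizationData W N)
    (hopt : D₁.IsOptimal)
    (V : WeierstrassCurve ℚ) [V.IsElliptic] [V.IsGloballyMinimal] (h4 : V.c₄ = 0) (hN : 2 ^ 2 ∣ N)
    (hiso : WeierstrassCurve.IsIsogenous V W)
    (hred : ∀ (W' : WeierstrassCurve ℚ) [W'.IsElliptic] [W'.IsGloballyMinimal],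
        W'.j = 0 → WeierstrassCurve.IsIsogenous V W' → (W'.c₆ = V.c₆ ∨ W'.c₆ = -27 * V.c₆)) :
    KatoFactTwoAt W D₁.f := by
  obtain ⟨LV, hLV⟩ := exists_isNeronLatticeOf_holds (V.baseChange ℂ)
  exact katoFactTwoAt_on_cmClass_three_of_rootLawAtTwo_of_classMembers h hcl hL W D₁ hopt V LV h4 hN hiso hLV hred

/-! ## §3 Fully discharged forms: `hL` («Faltings» = Knapp 11.67) is the tree theorem `LFunction_eq_of_isIsogenous_holds` -/

/-- **6♭‴|CM(ℚ(i)), discharged form**: conditional ONLY on the root law E-es-152₂ and the classification SHAPE₂⁺ — the binders `hL` (tree theorem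
`LFunction_eq_of_isIsogenous_holds`, Knapp 11.67) and `(LR, hLR)` (uniformisation `exists_isNeronLatticeOf_holds`) are discharged by name. [folklore] -/
theorem katoFactTwoAt_on_cmClass_two
    (h152 : CMGammaOneRootLawTwoLocal) (hcl : CMClassMembersTwo)
    (V : WeierstrassCurve ℚ) [V.IsElliptic] [V.IsGloballyMinimal] (D₁ : Gamma1ParametrizationData V N)
    (hopt : D₁.IsOptimal)
    (R : WeierstrassCurve ℚ) [R.IsElliptic] [R.IsGloballyMinimal] (h6 : R.c₆ = 0)
    (hiso : WeierstrassCurve.IsIsogenous R V)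
    (hred : ∀ (W' : WeierstrassCurve ℚ) [W'.IsElliptic] [W'.IsGloballyMinimal],
        W'.j = 1728 → WeierstrassCurve.IsIsogenous R W' → (W'.c₄ = R.c₄ ∨ W'.c₄ = -4 * R.c₄)) :
    KatoFactTwoAt V D₁.f :=
  katoFactTwoAt_on_cmClass_two_noLattice h152 hcl LFunction_eq_of_isIsogenous_holds V D₁ hopt R h6 hiso hred

/-- **C2 on the `ℚ(i)`-CM classes for `X₁(N)`-data, discharged form** (`2 ∤ c₁(D₁)`): es's COR 46.S₂⁺ with `hL` and `(LR, hLR)` discharged by name;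
conditional only on E-es-152₂ and SHAPE₂⁺. [folklore] -/
theorem not_two_dvd_maninConstant₁_on_cmClass_two
    (h152 : CMGammaOneRootLawTwoLocal) (hcl : CMClassMembersTwo)
    (V : WeierstrassCurve ℚ) [V.IsElliptic] [V.IsGloballyMinimal] (D₁ : Gamma1ParametrizationData V N)
    (hopt : D₁.IsOptimal)
    (R : WeierstrassCurve ℚ) [R.IsElliptic] [R.IsGloballyMinimal] (h6 : R.c₆ = 0)
    (hiso : WeierstrassCurve.IsIsogenous R V)
    (hred : ∀ (W' : WeierstrassCurve ℚ) [W'.IsElliptic] [W'.IsGloballyMinimal],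
        W'.j = 1728 → WeierstrassCurve.IsIsogenous R W' → (W'.c₄ = R.c₄ ∨ W'.c₄ = -4 * R.c₄)) :
    ¬ (2 : ℤ) ∣ D₁.maninConstant := by
  obtain ⟨LR, hLR⟩ := exists_isNeronLatticeOf_holds (R.baseChange ℂ)
  exact not_two_dvd_maninConstant₁_on_cmClass_two_of_rootLaw_of_classMembers h152 hcl LFunction_eq_of_isIsogenous_holds V D₁
    hopt R LR h6 hiso hLR hred

/-- **6♭‴|CM(ℚ(√−3)) at 2, discharged form**: conditional ONLY on E-es-155 and SHAPE₃⁺ (`hL` and `(LV, hLV)` discharged by name). [folklore] -/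
theorem katoFactTwoAt_on_cmClass_three_atTwo
    (h : CMGammaOneRootLawTwoLocalJ0) (hcl : CMClassMembersThree)
    (W : WeierstrassCurve ℚ) [W.IsElliptic] [W.IsGloballyMinimal] (D₁ : Gamma1ParametrizationData W N)
    (hopt : D₁.IsOptimal)
    (V : WeierstrassCurve ℚ) [V.IsElliptic] [V.IsGloballyMinimal] (h4 : V.c₄ = 0) (hN : 2 ^ 2 ∣ N)
    (hiso : WeierstrassCurve.IsIsogenous V W)
    (hred : ∀ (W' : WeierstrassCurve ℚ) [W'.IsElliptic] [W'.IsGloballyMinimal],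
        W'.j = 0 → WeierstrassCurve.IsIsogenous V W' → (W'.c₆ = V.c₆ ∨ W'.c₆ = -27 * V.c₆)) :
    KatoFactTwoAt W D₁.f :=
  katoFactTwoAt_on_cmClass_three_of_rootLawAtTwo_noLattice h hcl LFunction_eq_of_isIsogenous_holds W D₁ hopt V h4 hN hiso hred

/-- **C2 on the `ℚ(√−3)`-CM classes at 2 for `X₁(N)`-data, discharged form** (`2 ∤ c₁(D₁)`): es's COR 47.R (√−3 at 2) with `hL` and `(LV, hLV)`
discharged by name; conditional only on E-es-155 and SHAPE₃⁺. [folklore] -/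
theorem not_two_dvd_maninConstant₁_on_cmClass_three_atTwo
    (h : CMGammaOneRootLawTwoLocalJ0) (hcl : CMClassMembersThree)
    (W : WeierstrassCurve ℚ) [W.IsElliptic] [W.IsGloballyMinimal] (D₁ : Gamma1ParametrizationData W N)
    (hopt : D₁.IsOptimal)
    (V : WeierstrassCurve ℚ) [V.IsElliptic] [V.IsGloballyMinimal] (h4 : V.c₄ = 0) (hN : 2 ^ 2 ∣ N)
    (hiso : WeierstrassCurve.IsIsogenous V W)
    (hred : ∀ (W' : WeierstrassCurve ℚ) [W'.IsElliptic] [W'.IsGloballyMinimal],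
        W'.j = 0 → WeierstrassCurve.IsIsogenous V W' → (W'.c₆ = V.c₆ ∨ W'.c₆ = -27 * V.c₆)) :
    ¬ (2 : ℤ) ∣ D₁.maninConstant :=
  not_two_dvd_maninConstant₁_on_cmClass_three_of_rootLawAtTwo_noLattice h hcl LFunction_eq_of_isIsogenous_holds W D₁ hopt V
    h4 hN hiso hred

end Summit.BirchSwinnertonDyer.BirchSwinnertonDyer.Theorems.ManinLocalTwoThree.KatoNeronCM

end
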